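import Mathlib
import Summits.ValiantsHypothesis.ValiantsHypothesis.Theorems.BarrierLeverPartitionMinorsHitByVPHiddenStatesFullJoinTrace

/-!
# Route BarrierLever — item `PartitionMinorsHitByVP` (stmt-ValiantsHypothesis-19717), line `hidden_states`:
# SMALL-CORE DESIGNS ARE UNIVERSAL IN THE SAUER–SHELAH RANGE — any down-set core `C ⊆ 2^[m]` plus free states serves every row
# family of size `|C| + F > Σ_{i<m} C(h,i)`; in particular the FLAT design in its whole PAIR LAYER (core on `m` states)

Helper file (`--supports stmt-ValiantsHypothesis-19717`; cell valiant-natproofs, rung V4, 𝒟-side door (c), line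
`Cruxes/PartitionMinorsHitByVP/Lines/hidden_states.lean` v9; prover seat val-np-p3 gen 17; mandate R26 (ii): «UTD-flat — the pair layer»).
Three small `def`s (a design, its core states, its weights); closes NO item. Generalises `…FullJoinCubeCore` (p685295: `C = 2^[m]`).

* `coreDesign C F` — for a family `C : Finset (Finset (Fin m))` the one-cube design on `K = m + F` states whose members are the sets of `C`
  (on the first `m` states) and the `F` free singletons; `coreDesign_injective`; `coreDesign_threshold`: if `C` is a STRICT THRESHOLD family
  (`J ∈ C ↔ Σ_{q∈J} w q < θ`, positive weights, `2 ≤ θ`) then `coreDesign C F` is a strict threshold family for `coreWt` (core `w`, free `θ − 1`).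
* **`coreDesign_universal`** — if `C` is a DOWN-SET and `Σ_{i<m} C(h,i) < |C| + F` (`0 < h`), then for EVERY injective `u : Fin (|C|+F) → Finset (Fin h)`
  some block-additive table makes the design matrix nonsingular: by Sauer–Shelah (`exists_shatters_of_card_gt`) `u` shatters an `m`-set `A`, so
  every member of `C` is realised as a trace on `A`, and the trace criterion (`exists_table_of_core_trace`, p684990) applies.
  `universalThresholdDesign_body_coreDesign`: the body of `FullJoin.Stmt.universalThresholdDesign` at `(h, |C| + F)` for threshold cores, `m + F ≤ h³`.
* WHY THIS IS «THE PAIR LAYER OF UTD-flat» (and more): the flat colex design `S_flat(r)` on `K` states with `t = r − 1 − K ≤ C(m,2)` pairs is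
  `coreDesign C (K − m)` for the core `C = B₁([m]) ∪ (first t pairs in colex)` — a down-set and a strict threshold family on `m` states. Hence
  **UTD-flat(K) holds at `(h, r)` for every row family as soon as the pair core fits in `m` states and `r > Σ_{i<m} C(h,i)`** (e.g. `m = 2`:
  the first pair, `r ≥ h + 2` — `…FullJoinCubeCore.firstPair_universal`; `m = 3`: up to three pairs, `r > 1 + h + C(h,2)`; …). The same holds for
  ball cores `B_s([m])`, cube cores, and every threshold core.

HONEST RANGE: `r > Σ_{i<m} C(h,i)` with a core of at most `2^m` members keeps this in the polynomial range of the item (already unconditional,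
p680788); the census of this seat (memo §3i) shows that the «K = 3h» successes of the flat design at small `h` are exactly this regime. The
exponential middle range of the node is untouched. Item 19717 stays OPEN; nothing on crux 14610 or VP ≠ VNP.
-/

set_option linter.dupNamespace false

namespace Summit.ValiantsHypothesis.ValiantsHypothesis.Theorems.BarrierLever.HiddenStates

open Finset Matrix

noncomputable section

namespace FullJoin

variable {h : ℕ}

/-! ## 1. The design «core `C` on the first `m` states + `F` free singletons» -/

/-- Cardinalities: `|C| + F = |C ⊔ [F]|`. -/
theorem core_card {m : ℕ} (C : Finset (Finset (Fin m))) (F : ℕ) :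
    Fintype.card (Fin (#C + F)) = Fintype.card ({J // J ∈ C} ⊕ Fin F) := by
  simp [Fintype.card_sum]

/-- A fixed indexing bijection `Fin (|C| + F) ≃ C ⊔ [F]`. -/
def coreEquiv {m : ℕ} (C : Finset (Finset (Fin m))) (F : ℕ) : Fin (#C + F) ≃ ({J // J ∈ C} ⊕ Fin F) :=
  Fintype.equivOfCardEq (core_card C F)

/-- **The core design**: the members of `C` on the core states `{0,…,m−1}` and the singletons `{m + j}` of the `F` free states. -/
def coreDesign {m : ℕ} (C : Finset (Finset (Fin m))) (F : ℕ) (k : Fin (#C + F)) : Finset (Fin (m + F)) :=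
  Sum.elim (fun J : {J // J ∈ C} => J.1.map (Fin.castAddEmb F)) (fun j : Fin F => {Fin.natAdd m j}) (coreEquiv C F k)

/-- The core states. -/
def coreStates (m F : ℕ) : Finset (Fin (m + F)) := (Finset.univ : Finset (Fin m)).map (Fin.castAddEmb F)

/-- The state weights: a core state `q < m` weighs `w q`, a free state weighs `θ − 1`. -/
def coreWt {m : ℕ} (w : Fin m → ℕ) (θ F : ℕ) (q : Fin (m + F)) : ℕ :=
  if hq : (q : ℕ) < m then w ⟨q, hq⟩ else θ - 1


/-- The weight of a core state. -/
theorem coreWt_castAdd {m : ℕ} (w : Fin m → ℕ) (θ F : ℕ) (i : Fin m) : coreWt w θ F (Fin.castAddEmb F i) = w i := by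
  unfold coreWt
  split_ifs with hq
  · congr 1
  · exact absurd (by simp [Fin.castAddEmb_apply]) hq

/-- A state is a core state iff its index is `< m`. -/
theorem mem_coreStates {m F : ℕ} {q : Fin (m + F)} : q ∈ coreStates m F ↔ (q : ℕ) < m := by
  constructor
  · intro hq
    obtain ⟨j, _, rfl⟩ := Finset.mem_map.mp hq
    simp
  · intro hq
    exact Finset.mem_map.mpr ⟨⟨q, hq⟩, Finset.mem_univ _, by ext; simp⟩

/-- The members indexed through `inl J` are the core sets `J`. -/
theorem coreDesign_inl {m : ℕ} {C : Finset (Finset (Fin m))} {F : ℕ} {k : Fin (#C + F)} {J : {J // J ∈ C}}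
    (hk : coreEquiv C F k = Sum.inl J) : coreDesign C F k = J.1.map (Fin.castAddEmb F) := by
  simp [coreDesign, hk]

/-- The members indexed through `inr j` are the free singletons. -/
theorem coreDesign_inr {m : ℕ} {C : Finset (Finset (Fin m))} {F : ℕ} {k : Fin (#C + F)} {j : Fin F}
    (hk : coreEquiv C F k = Sum.inr j) : coreDesign C F k = {Fin.natAdd m j} := by
  simp [coreDesign, hk]

/-- The core design is an injective family. -/
theorem coreDesign_injective {m : ℕ} (C : Finset (Finset (Fin m))) (F : ℕ) : Function.Injective (coreDesign C F) := by
  intro k k' hkk'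
  apply (coreEquiv C F).injective
  rcases hk : coreEquiv C F k with J | j <;> rcases hk' : coreEquiv C F k' with J' | j'
  · rw [coreDesign_inl hk, coreDesign_inl hk'] at hkk'
    rw [Subtype.ext ((Finset.map_injective (Fin.castAddEmb F)) hkk')]
  · exfalso
    rw [coreDesign_inl hk, coreDesign_inr hk'] at hkk'
    have : Fin.natAdd m j' ∈ J.1.map (Fin.castAddEmb F) := by rw [hkk']; exact Finset.mem_singleton_self _
    obtain ⟨i, _, hi⟩ := Finset.mem_map.mp this
    have := congrArg Fin.val hi
    simp at this
    omega
  · exfalso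
    rw [coreDesign_inr hk, coreDesign_inl hk'] at hkk'
    have : Fin.natAdd m j ∈ J'.1.map (Fin.castAddEmb F) := by rw [← hkk']; exact Finset.mem_singleton_self _
    obtain ⟨i, _, hi⟩ := Finset.mem_map.mp this
    have := congrArg Fin.val hi
    simp at this
    omega
  · rw [coreDesign_inr hk, coreDesign_inr hk', Finset.singleton_inj] at hkk'
    have := congrArg Fin.val hkk'
    simp at this
    rw [Fin.ext this]

/-- A member lies inside the core states iff it is a core member. -/
theorem coreDesign_subset_core_iff {m : ℕ} {C : Finset (Finset (Fin m))} {F : ℕ} {k : Fin (#C + F)} :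
    coreDesign C F k ⊆ coreStates m F ↔ ∃ J, coreEquiv C F k = Sum.inl J := by
  rcases hk : coreEquiv C F k with J | j
  · simp only [coreDesign_inl hk, Sum.inl.injEq, exists_eq', iff_true]
    intro q hq
    obtain ⟨i, _, rfl⟩ := Finset.mem_map.mp hq
    exact mem_coreStates.mpr (by simp)
  · simp only [coreDesign_inr hk, reduceCtorEq, exists_false, iff_false, Finset.singleton_subset_iff,
      mem_coreStates, Fin.natAdd]
    omega

/-- For a DOWN-SET core, every subset of a core member is a member of the design. -/
theorem coreDesign_down {m : ℕ} (C : Finset (Finset (Fin m))) (F : ℕ)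
    (hdown : ∀ J ∈ C, ∀ I ⊆ J, I ∈ C) (k : Fin (#C + F)) (hk : coreDesign C F k ⊆ coreStates m F)
    (I : Finset (Fin (m + F))) (hI : I ⊆ coreDesign C F k) : ∃ k', coreDesign C F k' = I := by
  obtain ⟨J, hJ⟩ := coreDesign_subset_core_iff.mp hk
  rw [coreDesign_inl hJ] at hI
  obtain ⟨I₀, hI₀, rfl⟩ := Finset.subset_map_iff.mp hI
  refine ⟨(coreEquiv C F).symm (Sum.inl ⟨I₀, hdown J.1 J.2 I₀ hI₀⟩), ?_⟩
  exact coreDesign_inl (J := ⟨I₀, hdown J.1 J.2 I₀ hI₀⟩) (by rw [Equiv.apply_symm_apply])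

/-- **The core design of a STRICT THRESHOLD core is a strict threshold family** (weights: core `w`, free `θ − 1`). -/
theorem coreDesign_threshold {m : ℕ} (C : Finset (Finset (Fin m))) (F : ℕ) (w : Fin m → ℕ) (θ : ℕ)
    (hθ : 2 ≤ θ) (hw : ∀ q, 1 ≤ w q) (hC : ∀ J : Finset (Fin m), J ∈ C ↔ ∑ q ∈ J, w q < θ)
    (J' : Finset (Fin (m + F))) (hJ' : J' ∉ Set.range (coreDesign C F)) (k : Fin (#C + F)) :
    ∑ q ∈ coreDesign C F k, coreWt w θ F q < ∑ q ∈ J', coreWt w θ F q := by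
  classical
  -- member weight ≤ θ − 1
  have hmem : ∑ q ∈ coreDesign C F k, coreWt w θ F q ≤ θ - 1 := by
    rcases hk : coreEquiv C F k with J | j
    · rw [coreDesign_inl hk, Finset.sum_map]
      rw [Finset.sum_congr rfl fun i _ => coreWt_castAdd w θ F i]
      have h1 : ∑ q ∈ J.1, w q < θ := (hC J.1).mp J.2
      have h2 : (J.1).sum w = ∑ q ∈ J.1, w q := rfl
      omega
    · rw [coreDesign_inr hk, Finset.sum_singleton]
      simp [coreWt]
  -- a non-member: either inside the core states (then a non-member of `C`, weight ≥ θ) or containing a free state and a second state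
  by_cases hsub : J' ⊆ coreStates m F
  · obtain ⟨J₀, _, hJ₀⟩ := Finset.subset_map_iff.mp hsub
    have hnot : J₀ ∉ C := by
      intro hJ₀C
      apply hJ'
      refine ⟨(coreEquiv C F).symm (Sum.inl ⟨J₀, hJ₀C⟩), ?_⟩
      rw [coreDesign_inl (J := ⟨J₀, hJ₀C⟩) (by simp), hJ₀]
    have hge : θ ≤ ∑ q ∈ J₀, w q := by
      by_contra hlt; exact hnot ((hC J₀).mpr (by omega))
    have hsum : ∑ q ∈ J', coreWt w θ F q = ∑ q ∈ J₀, w q := by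
      rw [hJ₀, Finset.sum_map]
      exact Finset.sum_congr rfl fun i _ => coreWt_castAdd w θ F i
    have h2 : J₀.sum w = ∑ q ∈ J₀, w q := rfl
    omega
  · obtain ⟨q₀, hq₀J, hq₀⟩ := Finset.not_subset.mp hsub
    rw [mem_coreStates, not_lt] at hq₀
    have hne : J' ≠ {q₀} := by
      rintro rfl
      apply hJ'
      have hlt : (q₀ : ℕ) - m < F := by omega
      refine ⟨(coreEquiv C F).symm (Sum.inr ⟨(q₀ : ℕ) - m, hlt⟩), ?_⟩
      rw [coreDesign_inr (j := ⟨(q₀ : ℕ) - m, hlt⟩) (by simp), Finset.singleton_inj]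
      ext
      simp only [Fin.natAdd_mk]
      omega
    obtain ⟨q₁, hq₁J, hq₁⟩ : ∃ q₁ ∈ J', q₁ ≠ q₀ := by
      by_contra hall
      push Not at hall
      apply hne
      ext q
      simp only [Finset.mem_singleton]
      exact ⟨fun hq => hall q hq, fun hq => hq ▸ hq₀J⟩
    have h2 : coreWt w θ F q₀ + coreWt w θ F q₁ ≤ ∑ q ∈ J', coreWt w θ F q := by
      rw [← Finset.sum_pair hq₁.symm]
      exact Finset.sum_le_sum_of_subset_of_nonneg (by
        intro q hq
        simp only [Finset.mem_insert, Finset.mem_singleton] at hq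
        rcases hq with rfl | rfl <;> assumption) (fun _ _ _ => Nat.zero_le _)
    have hw0 : coreWt w θ F q₀ = θ - 1 := by
      simp only [coreWt]; rw [dif_neg (by omega)]
    have hw1 : 1 ≤ coreWt w θ F q₁ := by
      simp only [coreWt]; split_ifs
      · exact hw _
      · omega
    omega

/-! ## 2. Universality in the Sauer–Shelah range -/

/-- **SMALL DOWN-SET CORES ARE UNIVERSAL.** For a down-set `C ⊆ 2^[m]`, `0 < h` and `Σ_{i<m} C(h,i) < |C| + F`, every injective row
family of `|C| + F` subsets of `Fin h` admits a block-additive table making the design matrix of `coreDesign C F` nonsingular. -/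
theorem coreDesign_universal {m F : ℕ} (hh : 0 < h) (C : Finset (Finset (Fin m)))
    (hdown : ∀ J ∈ C, ∀ I ⊆ J, I ∈ C) (hr : ∑ i ∈ Finset.range m, h.choose i < #C + F)
    (u : Fin (#C + F) → Finset (Fin h)) (hu : Function.Injective u) :
    ∃ tx : Option (Fin (m + F)) → Fin h → ℂ,
      (Matrix.of fun i k : Fin (#C + F) =>
        ∏ a ∈ u i, (tx none a + ∑ q ∈ coreDesign C F k, tx (some q) a)).det ≠ 0 := by
  classical
  obtain ⟨A, hA, hsh⟩ := exists_shatters_of_card_gt u hu m hr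
  -- the core states are sent onto `A` in order
  set ι : Fin (m + F) → Fin h := fun q => if hq : (q : ℕ) < m then A.orderEmbOfFin hA ⟨q, hq⟩ else ⟨0, hh⟩ with hι
  have hιcore : ∀ i : Fin m, ι (Fin.castAddEmb F i) = A.orderEmbOfFin hA i := by
    intro i
    simp only [hι, Fin.castAddEmb_apply, Fin.val_castAdd, Fin.is_lt, ↓reduceDIte, Fin.eta]
  have hinj : Set.InjOn ι (coreStates m F) := by
    intro q hq q' hq' hqq'
    obtain ⟨i, _, rfl⟩ := Finset.mem_map.mp (Finset.mem_coe.mp hq)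
    obtain ⟨i', _, rfl⟩ := Finset.mem_map.mp (Finset.mem_coe.mp hq')
    rw [hιcore, hιcore] at hqq'
    rw [(A.orderEmbOfFin hA).injective hqq']
  have himage_core : (coreStates m F).image ι = A := by
    rw [coreStates, Finset.map_eq_image, Finset.image_image]
    have : ι ∘ (Fin.castAddEmb F) = A.orderEmbOfFin hA := funext hιcore
    rw [this]
    exact Finset.image_orderEmbOfFin_univ A hA
  refine exists_table_of_core_trace u hu (coreDesign C F) (coreDesign_injective C F) (coreStates m F) ι hinj ?_ ?_ ?_
  · intro k hk
    rcases hk' : coreEquiv C F k with J | j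
    · exact absurd (coreDesign_subset_core_iff.mpr ⟨J, hk'⟩) hk
    · refine ⟨Fin.natAdd m j, ?_, coreDesign_inr hk'⟩
      rw [mem_coreStates]; simp
  · intro k hk I hI
    exact coreDesign_down C F hdown k hk I hI
  · intro k hk
    have hsubA : (coreDesign C F k).image ι ⊆ A := by
      rw [← himage_core]; exact Finset.image_subset_image hk
    obtain ⟨W, hW, hAW⟩ := hsh hsubA
    obtain ⟨i, _, rfl⟩ := Finset.mem_image.mp hW
    exact ⟨i, by rw [himage_core, Finset.inter_comm, hAW]⟩

/-- **The body of `FullJoin.Stmt.universalThresholdDesign` at `(h, |C| + F)` from a strict-threshold down-set core** in the Sauer–Shelah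
range, within the state budget `m + F ≤ h³`. -/
theorem universalThresholdDesign_body_coreDesign {m F : ℕ} (hh : 0 < h) (C : Finset (Finset (Fin m)))
    (hdown : ∀ J ∈ C, ∀ I ⊆ J, I ∈ C) (w : Fin m → ℕ) (θ : ℕ) (hθ : 2 ≤ θ) (hw : ∀ q, 1 ≤ w q)
    (hC : ∀ J : Finset (Fin m), J ∈ C ↔ ∑ q ∈ J, w q < θ)
    (hr : ∑ i ∈ Finset.range m, h.choose i < #C + F) (hK : m + F ≤ h * h * h) :
    ∃ (K : ℕ) (J : Fin (#C + F) → Finset (Fin K)) (wt : Fin K → ℕ), K ≤ h * h * h ∧ Function.Injective J ∧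
      (∀ J' : Finset (Fin K), J' ∉ Set.range J → ∀ k : Fin (#C + F), ∑ q ∈ J k, wt q < ∑ q ∈ J', wt q) ∧
      ∀ u : Fin (#C + F) → Finset (Fin h), Function.Injective u →
        ∃ tx : Option (Fin K) → Fin h → ℂ,
          (Matrix.of fun i k : Fin (#C + F) => ∏ a ∈ u i, (tx none a + ∑ q ∈ J k, tx (some q) a)).det ≠ 0 :=
  ⟨m + F, coreDesign C F, coreWt w θ F, hK, coreDesign_injective C F, coreDesign_threshold C F w θ hθ hw hC,
    fun u hu => coreDesign_universal hh C hdown hr u hu⟩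

end FullJoin

end

end Summit.ValiantsHypothesis.ValiantsHypothesis.Theorems.BarrierLever.HiddenStates
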